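import Mathlib

/-!
# HIGH-SET LEMMA (transfer g9, §7s) — kernel plate

Flatness of a weighted mixture of 4-letter alphabets means the weighted averages of the
elementary symmetric functions `(e₁,e₂,e₃,e₄)` of the squared letters equal the flat target
`(16,36,16,1)`.  The functional `f = (e₁+e₂+e₃) - 34·(1+e₄)` is affine and vanishes at the
target, so every flat mixture has a member with `f ≥ 0`, i.e. with
`R = (1+e₁+e₂+e₃+e₄)/(1+e₄) ≥ 35`.  This file proves exactly that averaging statement
(no design-theoretic content; the alphabets enter only through four real-valued functions).
HC / HC_CM / HC_AV / `BlochSeedDiscOne` are NOT touched or proved here.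
-/

namespace Summit.HodgeConjecture.HodgeConjecture.Cruxes.BlochSeedDiscOne.HighSet

open Finset BigOperators

/-- Averaging form: if positive weights `w` make the mixture flat
(`∑ w·e₁ = 16·∑ w`, `∑ w·e₂ = 36·∑ w`, `∑ w·e₃ = 16·∑ w`, `∑ w·e₄ = ∑ w`),
some member satisfies `34·(1+e₄) ≤ e₁+e₂+e₃`. -/
theorem exists_high_of_flat {ι : Type*} (s : Finset ι) (hs : s.Nonempty)
    (w e₁ e₂ e₃ e₄ : ι → ℝ) (hw : ∀ i ∈ s, 0 < w i)
    (h₁ : ∑ i ∈ s, w i * e₁ i = 16 * ∑ i ∈ s, w i)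
    (h₂ : ∑ i ∈ s, w i * e₂ i = 36 * ∑ i ∈ s, w i)
    (h₃ : ∑ i ∈ s, w i * e₃ i = 16 * ∑ i ∈ s, w i)
    (h₄ : ∑ i ∈ s, w i * e₄ i = ∑ i ∈ s, w i) :
    ∃ i ∈ s, 34 * (1 + e₄ i) ≤ e₁ i + e₂ i + e₃ i := by
  have hsum : ∑ i ∈ s, w i * (34 * (1 + e₄ i)) = ∑ i ∈ s, w i * (e₁ i + e₂ i + e₃ i) := by
    have lhs : ∑ i ∈ s, w i * (34 * (1 + e₄ i)) = 34 * ∑ i ∈ s, w i + 34 * ∑ i ∈ s, w i * e₄ i := by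
      rw [Finset.mul_sum, Finset.mul_sum, ← Finset.sum_add_distrib]
      refine Finset.sum_congr rfl fun i _ => by ring
    have rhs : ∑ i ∈ s, w i * (e₁ i + e₂ i + e₃ i)
        = ∑ i ∈ s, w i * e₁ i + ∑ i ∈ s, w i * e₂ i + ∑ i ∈ s, w i * e₃ i := by
      rw [← Finset.sum_add_distrib, ← Finset.sum_add_distrib]
      refine Finset.sum_congr rfl fun i _ => by ring
    rw [lhs, rhs, h₁, h₂, h₃, h₄]; ring
  obtain ⟨i, hi, hle⟩ := Finset.exists_le_of_sum_le hs (le_of_eq hsum)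
  exact ⟨i, hi, le_of_mul_le_mul_left hle (hw i hi)⟩

/-- `R`-form: the same member has `R = (1+e₁+e₂+e₃+e₄)/(1+e₄) ≥ 35` provided `1+e₄ > 0`
(automatic for alphabets: `e₄` is a product of squares). -/
theorem R_ge_35 {e₁ e₂ e₃ e₄ : ℝ} (hpos : 0 < 1 + e₄)
    (h : 34 * (1 + e₄) ≤ e₁ + e₂ + e₃) :
    35 ≤ (1 + e₁ + e₂ + e₃ + e₄) / (1 + e₄) := by
  rw [le_div_iff₀ hpos]; linarith

/-- Contrapositive used by the census: if every member of a positively weighted family has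
`e₁+e₂+e₃ < 34·(1+e₄)` (i.e. `R < 35`), the family is not flat. -/
theorem not_flat_of_all_low {ι : Type*} (s : Finset ι) (hs : s.Nonempty)
    (w e₁ e₂ e₃ e₄ : ι → ℝ) (hw : ∀ i ∈ s, 0 < w i)
    (hlow : ∀ i ∈ s, e₁ i + e₂ i + e₃ i < 34 * (1 + e₄ i)) :
    ¬ (∑ i ∈ s, w i * e₁ i = 16 * ∑ i ∈ s, w i ∧ ∑ i ∈ s, w i * e₂ i = 36 * ∑ i ∈ s, w i ∧
       ∑ i ∈ s, w i * e₃ i = 16 * ∑ i ∈ s, w i ∧ ∑ i ∈ s, w i * e₄ i = ∑ i ∈ s, w i) := by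
  rintro ⟨h₁, h₂, h₃, h₄⟩
  obtain ⟨i, hi, hle⟩ := exists_high_of_flat s hs w e₁ e₂ e₃ e₄ hw h₁ h₂ h₃ h₄
  exact absurd (hlow i hi) (not_lt.mpr hle)

end Summit.HodgeConjecture.HodgeConjecture.Cruxes.BlochSeedDiscOne.HighSet
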